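import Literature.NumberTheory.EllipticCurves.HeightDensityFullBSDOffSm
import HarnessLib

/-!
# Rows (ii-1) and (ii-2) of `PERCENT-FULL.md` with the rank-part input discharged to Bhargava–Skinner–Zhang's pieces

`HeightDensityFullBSDOffS.lean` / `HeightDensityFullBSDOffSSieve.lean` type the `pub-bsdpct` cell's row
(ii-1) — for at least a proportion `c` of the curves `E_{A,B}/ℚ`, ordered by naive height, the rank part
of BSD with analytic rank `≤ 1` AND Miller's `BSD(E,p)` at every prime `p ≥ 5` of good ordinary
reduction outside the finite set `Z*(E)` (`FullBSDOffSgoPrime`) — and `HeightDensityFullBSDOffSm.lean`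
types row (ii-2) (additionally `BSD(E,p)` at every multiplicative `p ≥ 5` outside `M*(E) ∪ Z*(E)`,
`FullBSDOffSmPrime`), both as TRANSFER theorems: conditional on Duke 1997 Thm. 1, Skinner–Urban 2014
Thm. 2 (a) (bsd.S30), W. Zhang 2014 Thm. 1.6/1.4, modularity, Gross–Zagier–Kolyvagin (row (ii-2): also
Skinner 2016 Thm. C and the OPEN Skinner–Zhang 2014 Thm. 1.2), and on the rank-part INPUT
`hA : HeightDensityGE SatisfiesBSDRankLeOne c`, which there is a bare hypothesis (for `c = .6648`, the
tree's named fact `bhargava_skinner_zhang` = bsd.S27; for `c_rank = 0.66856…`, Theorem A′ of the cell's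
bundle, whose Lean package is not in this tree).

`LeadingTermBSZAssemblyProofs.lean` PROVES the rank-part input from its pieces
(`heightDensityGE_satisfiesBSDRankLeOne_of_pieces`; `bhargava_skinner_zhang_corrected_of_pieces` at
`0.6597`): the finite-height counts of

> M. Bhargava, C. Skinner, W. Zhang, arXiv:1407.1826 (2014), Cor. 26 (proof): "we thus obtain that the
> density of elliptic curves `E` over `ℚ`, when ordered by height, that have both algebraic and analytic
> rank `1` [resp. `0` or `1`] is at least …",

with Thms 21/23/25 entering through the tree's `cor26_count`, and the deep inputs — Thm 5 (the rank-`0`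
converse on `S₀(5) ∩ W`, `h5`), Thm 9 (the rank-`1` converse on `T ∩ S₁ ∩ W`, `h9`), Thm 13 (the
`5`-Selmer average `≤ 6` on the twist-stable unions `T ⊇ U`, `R ⊇ U₀`, `h13T`, `h13U₀`), Thm 15
(Dokchitser–Dokchitser, the named fact `even_selmerRank_sub_torsionRank_iff`), Thm 16 (`κ`), Lemmas 17–19
(the densities `μT`, `μR`, `ν`) and Lemma 20 (`W` has density one) — each an explicit hypothesis in the
shape the counting consumes. With the residue count of Lemma 18 CORRECTED (`2(p-1)²`, not `(2p-1)(p-1)`;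
kernel certificate in that file) the assembly gives `0.6597` (the printed `.6648` does not follow).

This file composes the two, exactly as `HeightDensityFullBSDOffSsRankZeroPieces.lean` does for the rank-`0`
row (ii-3a): rows (ii-1) and (ii-2), parametrised (`δ ≤ (19/24 + κ/12)·μT + 3/8·κ·μR - ν`) and at the
corrected Bhargava–Skinner–Zhang constant `0.6597`, with `hA` REPLACED by Bhargava–Skinner–Zhang's primary
inputs. Nothing is cited beyond the sources of the files composed; no definition and no named fact is
introduced (D-0026 debt `0`); no constant of the cell changes — the cell's audited rank-part constant
`c_rank = 3059480216411717/4576171406400000` (Theorem A′, finer cells at `5`) is NOT reproduced here and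
stays a hypothesis in `…_cRank_of_sieve`; what this file adds is a floor `0.6597` for rows (ii-1)/(ii-2)
whose every input is a published theorem taken as an explicit binder (row (ii-2): plus the OPEN
Skinner–Zhang binder), kernel-composed.

## References

* M. Bhargava, C. Skinner, W. Zhang, arXiv:1407.1826v2 (2014), Thms 5, 9, 13, 15, 16, 21, 23, 25,
  Lemmas 17–20, Cor. 26 (pp. 7–13). [cite: BhargavaSkinnerZhang2014, Cor. 26 (proof)]
* W. Duke, C. R. Acad. Sci. Paris 325 (1997) 813–818, Thm. 1. [cite: Duke1997, Thm. 1 (p. 815)]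
* C. Skinner, E. Urban, Invent. Math. 195 (2014) 1–277, Thm. 2 (a). [cite: SkinnerUrban2014, Thm. 2 (a)]
* W. Zhang, Camb. J. Math. 2 (2014) 191–253, Thm. 1.4, 1.6. [cite: WZhang2014, Thm. 1.6 (p. 199)]
* C. Skinner, Pacific J. Math. 283 (2016) 171–200, Thm. C (p. 173). [cite: Skinner2016PacificMC, Thm. C]
* C. Skinner, W. Zhang, arXiv:1407.1099 (2014), Thm. 1.2. [claim: SkinnerZhang2014, status: under-review]
* R. L. Miller, LMS J. Comput. Math. 14 (2011), Def. 1.1 (`BSDp`). [cite: Miller2011LMS, Def. 1.1]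
-/

noncomputable section

open scoped Classical
open scoped AddSubgroup
open WeierstrassCurve Filter Topology Literature.NumberTheory.EllipticCurves

namespace Literature.NumberTheory.EllipticCurves

/-- **Row (ii-1), from Bhargava–Skinner–Zhang's pieces (parametrised).** In the notation of
`heightDensityGE_satisfiesBSDRankLeOne_of_pieces` (families `S₀ ⊇ T ⊇ U`, `S₀ ⊇ R ⊇ U₀` with `R`
disjoint from `T`, `S₁`, `W`; twist-stability and reversed root numbers on `U`, `U₀`; Thm 5 as `h5`,
Thm 9 as `h9`, Thm 13 as `h13T`/`h13U₀`, Thm 15 as `hDD`; densities `μT`, `κ`, `μR`, `ν` and the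
density-one set `W`) and given Duke 1997 Thm. 1, Skinner–Urban 2014 Thm. 2 (a), W. Zhang 2014 Thm. 1.6,
modularity and Gross–Zagier–Kolyvagin: for every `δ ≤ (19/24 + κ/12)·μT + 3/8·κ·μR - ν`, at least a
proportion `δ` of the curves `E_{A,B}/ℚ`, ordered by naive height, satisfy the rank part of BSD with
analytic rank `≤ 1` AND `BSD(E,p)` at every prime `p ≥ 5` of good ordinary reduction outside `Z*(E)`
(`FullBSDOffSgoPrime`). `= HeightDensityGE.rankLeOne_and_fullBSDOffSgoPrime_of_sieve` with its binder
`hA` supplied by `heightDensityGE_satisfiesBSDRankLeOne_of_pieces`.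
[cite: BhargavaSkinnerZhang2014, Cor. 26 (proof)] [cite: SkinnerUrban2014, Thm. 2 (a)]
[cite: WZhang2014, Thm. 1.6 (p. 199)] [cite: Duke1997, Thm. 1 (p. 815)] -/
theorem HeightDensityGE.rankLeOne_and_fullBSDOffSgoPrime_of_pieces
    (hGZK : rank_eq_analyticRank_of_analyticRank_le_one)
    (hDD : even_selmerRank_sub_torsionRank_iff) (S₀ T U R U₀ S₁ W : ℤ × ℤ → Prop)
    (hTS₀ : ∀ AB, T AB → S₀ AB) (hUT : ∀ AB, U AB → T AB)
    (hRS₀ : ∀ AB, R AB → S₀ AB) (hRT : ∀ AB, R AB → ¬ T AB) (hU₀R : ∀ AB, U₀ AB → R AB)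
    (hU : ∀ AB, U AB → U (negB AB))
    (hUflip : ∀ AB, U AB →
      (shortWeierstrass (negB AB)).rootNumber = -(shortWeierstrass AB).rootNumber)
    (hU₀ : ∀ AB, U₀ AB → U₀ (negB AB))
    (hU₀flip : ∀ AB, U₀ AB →
      (shortWeierstrass (negB AB)).rootNumber = -(shortWeierstrass AB).rootNumber)
    (h5 : ∀ AB, IsInHeightFamily AB → S₀ AB → W AB →
      Nat.card ((shortWeierstrass AB).selmerGroup 5) = 1 →
        (shortWeierstrass AB).mordellWeilRank = 0 ∧ (shortWeierstrass AB).analyticRank = 0)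
    (h9 : ∀ AB, IsInHeightFamily AB → T AB → S₁ AB → W AB →
      Nat.card ((shortWeierstrass AB).selmerGroup 5) = 5 →
        (shortWeierstrass AB).mordellWeilRank = 1 ∧ (shortWeierstrass AB).analyticRank = 1)
    (hWtors : ∀ AB, IsInHeightFamily AB → W AB → (shortWeierstrass AB).toAffine.Point[(5 : ℤ)] = ⊥)
    (h13T : ∀ η : ℝ, 0 < η → ∀ᶠ X : ℕ in atTop,
      ∑ AB ∈ (heightFamilyBelow X).filter T,
          (Nat.card ((shortWeierstrass AB).selmerGroup 5) : ℝ) ≤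
        (6 + η) * ((heightFamilyBelow X).filter T).card)
    (h13U₀ : ∀ η : ℝ, 0 < η → ∀ᶠ X : ℕ in atTop,
      ∑ AB ∈ (heightFamilyBelow X).filter U₀,
          (Nat.card ((shortWeierstrass AB).selmerGroup 5) : ℝ) ≤
        (6 + η) * ((heightFamilyBelow X).filter U₀).card)
    {μT κ μR ν : ℝ} (hκ : 0 < κ) (hκ1 : κ ≤ 1) (hμT1 : μT ≤ 1) (hμR1 : μR ≤ 1)
    (hT : ∀ η : ℝ, 0 < η → ∀ᶠ X : ℕ in atTop,
      (μT - η) * (heightFamilyBelow X).card ≤ ((heightFamilyBelow X).filter T).card)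
    (hκU : ∀ η : ℝ, 0 < η → ∀ᶠ X : ℕ in atTop,
      (κ - η) * ((heightFamilyBelow X).filter T).card ≤ ((heightFamilyBelow X).filter U).card)
    (hR : ∀ η : ℝ, 0 < η → ∀ᶠ X : ℕ in atTop,
      (μR - η) * (heightFamilyBelow X).card ≤ ((heightFamilyBelow X).filter R).card)
    (hκU₀ : ∀ η : ℝ, 0 < η → ∀ᶠ X : ℕ in atTop,
      (κ - η) * ((heightFamilyBelow X).filter R).card ≤ ((heightFamilyBelow X).filter U₀).card)
    (hν : ∀ η : ℝ, 0 < η → ∀ᶠ X : ℕ in atTop,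
      (((heightFamilyBelow X).filter (fun AB ↦ T AB ∧ ¬ S₁ AB)).card : ℝ) ≤
        (ν + η) * (heightFamilyBelow X).card)
    (hW : ∀ η : ℝ, 0 < η → ∀ᶠ X : ℕ in atTop,
      (((heightFamilyBelow X).filter (fun AB ↦ ¬ W AB)).card : ℝ) ≤ η * (heightFamilyBelow X).card)
    (hD : Duke1997_exceptionalPrimes_densityZero)
    (hS30 : padicValRat_bsd_rank_zero) (hZ : WZhang2014_padicValRat_bsd_rank_one_ordinary)
    (hmod : hasEntireLFunction_rat)
    {δ : ℝ} (hδ : δ ≤ (19 / 24 + κ / 12) * μT + 3 / 8 * κ * μR - ν) :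
    HeightDensityGE (fun AB ↦ SatisfiesBSDRankLeOne AB ∧ FullBSDOffSgoPrime AB) δ :=
  HeightDensityGE.rankLeOne_and_fullBSDOffSgoPrime_of_sieve hD hS30 hZ hmod hGZK
    (heightDensityGE_satisfiesBSDRankLeOne_of_pieces hGZK hDD S₀ T U R U₀ S₁ W hTS₀ hUT hRS₀ hRT hU₀R
      hU hUflip hU₀ hU₀flip h5 h9 hWtors h13T h13U₀ hκ hκ1 hμT1 hμR1 hT hκU hR hκU₀ hν hW hδ)

/-- **Row (ii-1) at the corrected Bhargava–Skinner–Zhang constant `0.6597`, from the pieces** — the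
statement of `heightDensityGE_rankLeOne_and_fullBSDOffSgoPrime_of_bsz_of_sieve` with its named-fact
hypothesis `hBSZ : bhargava_skinner_zhang` (the printed `.6648`) replaced by the primary inputs at the
CORRECTED density of `S₁'(5)` (`bhargava_skinner_zhang_corrected_of_pieces`: `κ = .5501` (Thm 16),
`μT = .7838 ≤ μ(S₁'(5)) = .78381…`, `μR = .0161 ≤ μ(S₀(5)) - μ(S₁'(5))`, `ν = 10⁻⁵` (Lemma 19);
`(19/24 + .5501/12)·.7838 + 3/8·.5501·.0161 - 10⁻⁵ = .65975… ≥ .6597`): GIVEN Thm 5 on `S₀ ∩ W` (`h5`),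
Thm 9 on `T ∩ S₁ ∩ W` (`h9`), Thm 13 on `T` and on `U₀` (`h13T`, `h13U₀`), Thm 15 (`hDD`), the
densities (`hT`, `hκU`, `hR`, `hκU₀`, `hν`, `hW`), Duke 1997 Thm. 1, Skinner–Urban 2014 Thm. 2 (a),
W. Zhang 2014 Thm. 1.6, modularity and Gross–Zagier–Kolyvagin, at least `65.97%` of the curves
`E_{A,B}/ℚ`, ordered by naive height, satisfy the rank part of BSD with analytic rank `≤ 1` and `BSD(E,p)`
at every prime `p ≥ 5` of good ordinary reduction outside `Z*(E)`.
[cite: BhargavaSkinnerZhang2014, Cor. 26 (proof) with Lemma 18 corrected] [cite: SkinnerUrban2014, Thm. 2 (a)]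
[cite: WZhang2014, Thm. 1.6 (p. 199)] [cite: Duke1997, Thm. 1 (p. 815)] -/
theorem heightDensityGE_rankLeOne_and_fullBSDOffSgoPrime_bszCorrected_of_pieces
    (hGZK : rank_eq_analyticRank_of_analyticRank_le_one)
    (hDD : even_selmerRank_sub_torsionRank_iff) (S₀ T U R U₀ S₁ W : ℤ × ℤ → Prop)
    (hTS₀ : ∀ AB, T AB → S₀ AB) (hUT : ∀ AB, U AB → T AB)
    (hRS₀ : ∀ AB, R AB → S₀ AB) (hRT : ∀ AB, R AB → ¬ T AB) (hU₀R : ∀ AB, U₀ AB → R AB)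
    (hU : ∀ AB, U AB → U (negB AB))
    (hUflip : ∀ AB, U AB →
      (shortWeierstrass (negB AB)).rootNumber = -(shortWeierstrass AB).rootNumber)
    (hU₀ : ∀ AB, U₀ AB → U₀ (negB AB))
    (hU₀flip : ∀ AB, U₀ AB →
      (shortWeierstrass (negB AB)).rootNumber = -(shortWeierstrass AB).rootNumber)
    (h5 : ∀ AB, IsInHeightFamily AB → S₀ AB → W AB →
      Nat.card ((shortWeierstrass AB).selmerGroup 5) = 1 →
        (shortWeierstrass AB).mordellWeilRank = 0 ∧ (shortWeierstrass AB).analyticRank = 0)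
    (h9 : ∀ AB, IsInHeightFamily AB → T AB → S₁ AB → W AB →
      Nat.card ((shortWeierstrass AB).selmerGroup 5) = 5 →
        (shortWeierstrass AB).mordellWeilRank = 1 ∧ (shortWeierstrass AB).analyticRank = 1)
    (hWtors : ∀ AB, IsInHeightFamily AB → W AB → (shortWeierstrass AB).toAffine.Point[(5 : ℤ)] = ⊥)
    (h13T : ∀ η : ℝ, 0 < η → ∀ᶠ X : ℕ in atTop,
      ∑ AB ∈ (heightFamilyBelow X).filter T,
          (Nat.card ((shortWeierstrass AB).selmerGroup 5) : ℝ) ≤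
        (6 + η) * ((heightFamilyBelow X).filter T).card)
    (h13U₀ : ∀ η : ℝ, 0 < η → ∀ᶠ X : ℕ in atTop,
      ∑ AB ∈ (heightFamilyBelow X).filter U₀,
          (Nat.card ((shortWeierstrass AB).selmerGroup 5) : ℝ) ≤
        (6 + η) * ((heightFamilyBelow X).filter U₀).card)
    (hT : ∀ η : ℝ, 0 < η → ∀ᶠ X : ℕ in atTop,
      (0.7838 - η) * (heightFamilyBelow X).card ≤ ((heightFamilyBelow X).filter T).card)
    (hκU : ∀ η : ℝ, 0 < η → ∀ᶠ X : ℕ in atTop,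
      (0.5501 - η) * ((heightFamilyBelow X).filter T).card ≤ ((heightFamilyBelow X).filter U).card)
    (hR : ∀ η : ℝ, 0 < η → ∀ᶠ X : ℕ in atTop,
      (0.0161 - η) * (heightFamilyBelow X).card ≤ ((heightFamilyBelow X).filter R).card)
    (hκU₀ : ∀ η : ℝ, 0 < η → ∀ᶠ X : ℕ in atTop,
      (0.5501 - η) * ((heightFamilyBelow X).filter R).card ≤ ((heightFamilyBelow X).filter U₀).card)
    (hν : ∀ η : ℝ, 0 < η → ∀ᶠ X : ℕ in atTop,
      (((heightFamilyBelow X).filter (fun AB ↦ T AB ∧ ¬ S₁ AB)).card : ℝ) ≤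
        (0.00001 + η) * (heightFamilyBelow X).card)
    (hW : ∀ η : ℝ, 0 < η → ∀ᶠ X : ℕ in atTop,
      (((heightFamilyBelow X).filter (fun AB ↦ ¬ W AB)).card : ℝ) ≤ η * (heightFamilyBelow X).card)
    (hD : Duke1997_exceptionalPrimes_densityZero)
    (hS30 : padicValRat_bsd_rank_zero) (hZ : WZhang2014_padicValRat_bsd_rank_one_ordinary)
    (hmod : hasEntireLFunction_rat) :
    HeightDensityGE (fun AB ↦ SatisfiesBSDRankLeOne AB ∧ FullBSDOffSgoPrime AB) 0.6597 :=
  HeightDensityGE.rankLeOne_and_fullBSDOffSgoPrime_of_sieve hD hS30 hZ hmod hGZK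
    (bhargava_skinner_zhang_corrected_of_pieces hGZK hDD S₀ T U R U₀ S₁ W hTS₀ hUT hRS₀ hRT hU₀R hU
      hUflip hU₀ hU₀flip h5 h9 hWtors h13T h13U₀ hT hκU hR hκU₀ hν hW)

/-- **Row (ii-2), from Bhargava–Skinner–Zhang's pieces (parametrised).** As
`HeightDensityGE.rankLeOne_and_fullBSDOffSgoPrime_of_pieces`, and given in addition Skinner 2016
Thm. C (`hSk`) and the OPEN Skinner–Zhang 2014 Thm. 1.2 (`hSZ`, unrefereed; used only at multiplicative
primes in rank `1`): for every `δ ≤ (19/24 + κ/12)·μT + 3/8·κ·μR - ν`, at least a proportion `δ` of the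
curves `E_{A,B}/ℚ`, ordered by naive height, satisfy the rank part of BSD with analytic rank `≤ 1` AND
`BSD(E,p)` at every prime `p ≥ 5` that is good ordinary outside `Z*(E)` (`FullBSDOffSgoPrime`) or
multiplicative outside `M*(E) ∪ Z*(E)` (`FullBSDOffSmPrime`).
`= HeightDensityGE.rankLeOne_and_fullBSDOffSmPrime_of_sieve` with its binder `hA` supplied by
`heightDensityGE_satisfiesBSDRankLeOne_of_pieces`.
[cite: BhargavaSkinnerZhang2014, Cor. 26 (proof)] [cite: Skinner2016PacificMC, Thm. C]
[claim: SkinnerZhang2014, status: under-review] [cite: Duke1997, Thm. 1 (p. 815)] -/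
theorem HeightDensityGE.rankLeOne_and_fullBSDOffSmPrime_of_pieces
    (hGZK : rank_eq_analyticRank_of_analyticRank_le_one)
    (hDD : even_selmerRank_sub_torsionRank_iff) (S₀ T U R U₀ S₁ W : ℤ × ℤ → Prop)
    (hTS₀ : ∀ AB, T AB → S₀ AB) (hUT : ∀ AB, U AB → T AB)
    (hRS₀ : ∀ AB, R AB → S₀ AB) (hRT : ∀ AB, R AB → ¬ T AB) (hU₀R : ∀ AB, U₀ AB → R AB)
    (hU : ∀ AB, U AB → U (negB AB))
    (hUflip : ∀ AB, U AB →
      (shortWeierstrass (negB AB)).rootNumber = -(shortWeierstrass AB).rootNumber)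
    (hU₀ : ∀ AB, U₀ AB → U₀ (negB AB))
    (hU₀flip : ∀ AB, U₀ AB →
      (shortWeierstrass (negB AB)).rootNumber = -(shortWeierstrass AB).rootNumber)
    (h5 : ∀ AB, IsInHeightFamily AB → S₀ AB → W AB →
      Nat.card ((shortWeierstrass AB).selmerGroup 5) = 1 →
        (shortWeierstrass AB).mordellWeilRank = 0 ∧ (shortWeierstrass AB).analyticRank = 0)
    (h9 : ∀ AB, IsInHeightFamily AB → T AB → S₁ AB → W AB →
      Nat.card ((shortWeierstrass AB).selmerGroup 5) = 5 →
        (shortWeierstrass AB).mordellWeilRank = 1 ∧ (shortWeierstrass AB).analyticRank = 1)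
    (hWtors : ∀ AB, IsInHeightFamily AB → W AB → (shortWeierstrass AB).toAffine.Point[(5 : ℤ)] = ⊥)
    (h13T : ∀ η : ℝ, 0 < η → ∀ᶠ X : ℕ in atTop,
      ∑ AB ∈ (heightFamilyBelow X).filter T,
          (Nat.card ((shortWeierstrass AB).selmerGroup 5) : ℝ) ≤
        (6 + η) * ((heightFamilyBelow X).filter T).card)
    (h13U₀ : ∀ η : ℝ, 0 < η → ∀ᶠ X : ℕ in atTop,
      ∑ AB ∈ (heightFamilyBelow X).filter U₀,
          (Nat.card ((shortWeierstrass AB).selmerGroup 5) : ℝ) ≤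
        (6 + η) * ((heightFamilyBelow X).filter U₀).card)
    {μT κ μR ν : ℝ} (hκ : 0 < κ) (hκ1 : κ ≤ 1) (hμT1 : μT ≤ 1) (hμR1 : μR ≤ 1)
    (hT : ∀ η : ℝ, 0 < η → ∀ᶠ X : ℕ in atTop,
      (μT - η) * (heightFamilyBelow X).card ≤ ((heightFamilyBelow X).filter T).card)
    (hκU : ∀ η : ℝ, 0 < η → ∀ᶠ X : ℕ in atTop,
      (κ - η) * ((heightFamilyBelow X).filter T).card ≤ ((heightFamilyBelow X).filter U).card)
    (hR : ∀ η : ℝ, 0 < η → ∀ᶠ X : ℕ in atTop,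
      (μR - η) * (heightFamilyBelow X).card ≤ ((heightFamilyBelow X).filter R).card)
    (hκU₀ : ∀ η : ℝ, 0 < η → ∀ᶠ X : ℕ in atTop,
      (κ - η) * ((heightFamilyBelow X).filter R).card ≤ ((heightFamilyBelow X).filter U₀).card)
    (hν : ∀ η : ℝ, 0 < η → ∀ᶠ X : ℕ in atTop,
      (((heightFamilyBelow X).filter (fun AB ↦ T AB ∧ ¬ S₁ AB)).card : ℝ) ≤
        (ν + η) * (heightFamilyBelow X).card)
    (hW : ∀ η : ℝ, 0 < η → ∀ᶠ X : ℕ in atTop,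
      (((heightFamilyBelow X).filter (fun AB ↦ ¬ W AB)).card : ℝ) ≤ η * (heightFamilyBelow X).card)
    (hD : Duke1997_exceptionalPrimes_densityZero)
    (hS30 : padicValRat_bsd_rank_zero) (hZ : WZhang2014_padicValRat_bsd_rank_one_ordinary)
    (hSk : Skinner2016_padicValRat_bsd_rank_zero)
    (hSZ : SkinnerZhang2014.thm1_2_padicVal_bsd_rankOne_OPEN)
    (hmod : hasEntireLFunction_rat)
    {δ : ℝ} (hδ : δ ≤ (19 / 24 + κ / 12) * μT + 3 / 8 * κ * μR - ν) :
    HeightDensityGE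
      (fun AB ↦ SatisfiesBSDRankLeOne AB ∧ FullBSDOffSgoPrime AB ∧ FullBSDOffSmPrime AB) δ :=
  HeightDensityGE.rankLeOne_and_fullBSDOffSmPrime_of_sieve hD hS30 hZ hSk hSZ hmod hGZK
    (heightDensityGE_satisfiesBSDRankLeOne_of_pieces hGZK hDD S₀ T U R U₀ S₁ W hTS₀ hUT hRS₀ hRT hU₀R
      hU hUflip hU₀ hU₀flip h5 h9 hWtors h13T h13U₀ hκ hκ1 hμT1 hμR1 hT hκU hR hκU₀ hν hW hδ)

/-- **Row (ii-2) at the corrected Bhargava–Skinner–Zhang constant `0.6597`, from the pieces** — as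
`heightDensityGE_rankLeOne_and_fullBSDOffSgoPrime_bszCorrected_of_pieces` plus Skinner 2016 Thm. C and
the OPEN Skinner–Zhang 2014 Thm. 1.2: at least `65.97%` of the curves `E_{A,B}/ℚ`, ordered by naive
height, satisfy the rank part of BSD with analytic rank `≤ 1` and `BSD(E,p)` at every prime `p ≥ 5`
that is good ordinary outside `Z*(E)` or multiplicative outside `M*(E) ∪ Z*(E)`.
[cite: BhargavaSkinnerZhang2014, Cor. 26 (proof) with Lemma 18 corrected]
[cite: Skinner2016PacificMC, Thm. C] [claim: SkinnerZhang2014, status: under-review]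
[cite: Duke1997, Thm. 1 (p. 815)] -/
theorem heightDensityGE_rankLeOne_and_fullBSDOffSmPrime_bszCorrected_of_pieces
    (hGZK : rank_eq_analyticRank_of_analyticRank_le_one)
    (hDD : even_selmerRank_sub_torsionRank_iff) (S₀ T U R U₀ S₁ W : ℤ × ℤ → Prop)
    (hTS₀ : ∀ AB, T AB → S₀ AB) (hUT : ∀ AB, U AB → T AB)
    (hRS₀ : ∀ AB, R AB → S₀ AB) (hRT : ∀ AB, R AB → ¬ T AB) (hU₀R : ∀ AB, U₀ AB → R AB)
    (hU : ∀ AB, U AB → U (negB AB))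
    (hUflip : ∀ AB, U AB →
      (shortWeierstrass (negB AB)).rootNumber = -(shortWeierstrass AB).rootNumber)
    (hU₀ : ∀ AB, U₀ AB → U₀ (negB AB))
    (hU₀flip : ∀ AB, U₀ AB →
      (shortWeierstrass (negB AB)).rootNumber = -(shortWeierstrass AB).rootNumber)
    (h5 : ∀ AB, IsInHeightFamily AB → S₀ AB → W AB →
      Nat.card ((shortWeierstrass AB).selmerGroup 5) = 1 →
        (shortWeierstrass AB).mordellWeilRank = 0 ∧ (shortWeierstrass AB).analyticRank = 0)
    (h9 : ∀ AB, IsInHeightFamily AB → T AB → S₁ AB → W AB →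
      Nat.card ((shortWeierstrass AB).selmerGroup 5) = 5 →
        (shortWeierstrass AB).mordellWeilRank = 1 ∧ (shortWeierstrass AB).analyticRank = 1)
    (hWtors : ∀ AB, IsInHeightFamily AB → W AB → (shortWeierstrass AB).toAffine.Point[(5 : ℤ)] = ⊥)
    (h13T : ∀ η : ℝ, 0 < η → ∀ᶠ X : ℕ in atTop,
      ∑ AB ∈ (heightFamilyBelow X).filter T,
          (Nat.card ((shortWeierstrass AB).selmerGroup 5) : ℝ) ≤
        (6 + η) * ((heightFamilyBelow X).filter T).card)
    (h13U₀ : ∀ η : ℝ, 0 < η → ∀ᶠ X : ℕ in atTop,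
      ∑ AB ∈ (heightFamilyBelow X).filter U₀,
          (Nat.card ((shortWeierstrass AB).selmerGroup 5) : ℝ) ≤
        (6 + η) * ((heightFamilyBelow X).filter U₀).card)
    (hT : ∀ η : ℝ, 0 < η → ∀ᶠ X : ℕ in atTop,
      (0.7838 - η) * (heightFamilyBelow X).card ≤ ((heightFamilyBelow X).filter T).card)
    (hκU : ∀ η : ℝ, 0 < η → ∀ᶠ X : ℕ in atTop,
      (0.5501 - η) * ((heightFamilyBelow X).filter T).card ≤ ((heightFamilyBelow X).filter U).card)
    (hR : ∀ η : ℝ, 0 < η → ∀ᶠ X : ℕ in atTop,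
      (0.0161 - η) * (heightFamilyBelow X).card ≤ ((heightFamilyBelow X).filter R).card)
    (hκU₀ : ∀ η : ℝ, 0 < η → ∀ᶠ X : ℕ in atTop,
      (0.5501 - η) * ((heightFamilyBelow X).filter R).card ≤ ((heightFamilyBelow X).filter U₀).card)
    (hν : ∀ η : ℝ, 0 < η → ∀ᶠ X : ℕ in atTop,
      (((heightFamilyBelow X).filter (fun AB ↦ T AB ∧ ¬ S₁ AB)).card : ℝ) ≤
        (0.00001 + η) * (heightFamilyBelow X).card)
    (hW : ∀ η : ℝ, 0 < η → ∀ᶠ X : ℕ in atTop,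
      (((heightFamilyBelow X).filter (fun AB ↦ ¬ W AB)).card : ℝ) ≤ η * (heightFamilyBelow X).card)
    (hD : Duke1997_exceptionalPrimes_densityZero)
    (hS30 : padicValRat_bsd_rank_zero) (hZ : WZhang2014_padicValRat_bsd_rank_one_ordinary)
    (hSk : Skinner2016_padicValRat_bsd_rank_zero)
    (hSZ : SkinnerZhang2014.thm1_2_padicVal_bsd_rankOne_OPEN)
    (hmod : hasEntireLFunction_rat) :
    HeightDensityGE
      (fun AB ↦ SatisfiesBSDRankLeOne AB ∧ FullBSDOffSgoPrime AB ∧ FullBSDOffSmPrime AB) 0.6597 :=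
  HeightDensityGE.rankLeOne_and_fullBSDOffSmPrime_of_sieve hD hS30 hZ hSk hSZ hmod hGZK
    (bhargava_skinner_zhang_corrected_of_pieces hGZK hDD S₀ T U R U₀ S₁ W hTS₀ hUT hRS₀ hRT hU₀R hU
      hUflip hU₀ hU₀flip h5 h9 hWtors h13T h13U₀ hT hκU hR hκU₀ hν hW)

end Literature.NumberTheory.EllipticCurves

end
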